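import Summits.AnomalousDissipation.AnomalousDissipation.Theorems.GPStatisticalRigidity.Negative.DiracShadow
import Summits.AnomalousDissipation.AnomalousDissipation.Theorems.EnsembleRigidityGPStatisticalRigidityGpSmallEnergy
import Literature.Analysis.FluidPDE.StokesTorusConvectionMode
import Literature.Analysis.FunctionSpaces.TorusLinearisedNSEnergy
import Literature.Analysis.FunctionSpaces.TorusInverseLaplacianCalculus
import Literature.Analysis.FunctionSpaces.TorusHeatSmoothing
import HarnessLib

/-!
# `EnsembleRigidity.GPTameDefectFloor` (stmt-AnomalousDissipation-17938) — negative side, tools: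
# two-mode Stokes fields and the Galloway–Proctor atom pairs

Tools for `…Theorems.GPTameDefectFloor.Negative.LinearCeiling` (the ceiling of the linear certificate
layer of the crux `GPTameDefectFloor`; see that file for the statement and the mechanism). Proved here:

* `convect_stokesMode_eq_smul` — the advection of a Stokes mode along ANY field `u` is one mode:
  `(u·∇)(cos(2πk·x) a) = −2π⟪k,u⟫ sin(2πk·x) a`, `(u·∇)(sin(2πk·x) a) = 2π⟪k,u⟫ cos(2πk·x) a`;
* two-mode fields `V = stokesMode k a c + stokesMode m b c` (`a ⊥ b`, `k, m ≠ 0`): smooth, solenoidal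
  (`k ⊥ a`, `m ⊥ b`), mean-free, `∫|V|² = (|a|²+|b|²)/2` (`integral_norm_sq_twoMode`),
  `‖∇V‖₂² = 2π²(|k|²|a|² + |m|²|b|²)` (`gradNormSq_twoMode`, through `‖∇V‖₂² = −∫⟪ΔV, V⟫`);
* `convect_twoMode_pair` — THE QUARTER-PERIOD PAIR CANCELS THE SPILL: if moreover `k ⊥ a`, `m ⊥ a`,
  `m ⊥ b`, then `(V⁺·∇)V⁺ + (V⁻·∇)V⁻ = −2π⟪k, b⟫ sin(2π(k−m)·x) a` (`V⁺` cosine phase, `V⁻` sine phase):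
  the frequency-`(k+m)` contributions of the two phases cancel, the frequency-`(k−m)` ones add;
* the index algebra of the GP atom pair `k = e_q + e_c`, `m = e_q`, `a = A e_p`, `b = −B e_c`
  (`{p, c, q} = {0, 1, 2}`): `gpPair_*`, `freqNormSq_single(_add_single)`.

[folklore]
-/

set_option linter.dupNamespace false

noncomputable section

open MeasureTheory UnitAddTorus
open scoped ENNReal InnerProductSpace RealInnerProductSpace

namespace Summit.AnomalousDissipation.AnomalousDissipation.Theorems.GPTameDefectFloor.Negative

open Literature.Analysis.FunctionSpaces Literature.Analysis.FunctionSpaces.Torus Literature.Analysis.FluidPDE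
open Summit.AnomalousDissipation.AnomalousDissipation.Theorems.EnsembleRigidity (gpForce gpForce_eq)
open Summit.AnomalousDissipation.AnomalousDissipation.Theorems.TaylorCertificatePair.Negative

/-! ## Calculus of single Stokes modes -/

/-- `Re (z • v_ℂ) = (Re z) • v` for a real vector `v`. -/
theorem realPart_smul_complexify (z : ℂ) (v : (EuclideanSpace ℝ (Fin 3))) :
    EuclideanSpace.realPart (z • EuclideanSpace.complexify v) = z.re • v := by
  ext j
  simp [EuclideanSpace.realPart_apply, EuclideanSpace.complexify_apply, Complex.mul_re]

/-- **Advection of a Stokes mode** along any field `u`: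
`(u·∇)(cos(2πk·x) a) = −2π ⟪k, u⟫ sin(2πk·x) a`, `(u·∇)(sin(2πk·x) a) = 2π ⟪k, u⟫ cos(2πk·x) a`. -/
theorem convect_stokesMode_eq_smul (u : (UnitAddTorus (Fin 3) → EuclideanSpace ℝ (Fin 3))) (k : Fin 3 → ℤ) (a : (EuclideanSpace ℝ (Fin 3))) (c : Bool) (x : (UnitAddTorus (Fin 3))) :
    Torus.convect u (⇑(Torus.stokesMode k a c)) x =
      (⟪latticeVec k, u x⟫_ℝ *
        (2 * Real.pi * (if c then -(mFourier k x).im else (mFourier k x).re))) • a := by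
  rw [Torus.convect_stokesMode_apply, realTrigPoly_singleton_apply, smul_smul, smul_smul,
    realPart_smul_complexify, smul_smul]
  congr 2
  cases c <;> simp [Complex.mul_re, Complex.mul_im] <;> ring

/-- Additivity of `Torus.convect` in the transported field. -/
theorem convect_add_right (u : (UnitAddTorus (Fin 3) → EuclideanSpace ℝ (Fin 3))) {f g : (UnitAddTorus (Fin 3) → EuclideanSpace ℝ (Fin 3))} (hf : IsContDiff 1 f) (hg : IsContDiff 1 g) (x : (UnitAddTorus (Fin 3))) :
    Torus.convect u (f + g) x = Torus.convect u f x + Torus.convect u g x := by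
  unfold Torus.convect
  rw [Torus.fderiv_add hf hg]
  rfl

/-- Pointwise orthogonality of two Stokes modes with orthogonal amplitudes. -/
theorem inner_stokesMode_stokesMode_eq_zero (k m : Fin 3 → ℤ) {a b : (EuclideanSpace ℝ (Fin 3))} (hab : ⟪a, b⟫_ℝ = 0)
    (c c' : Bool) (x : (UnitAddTorus (Fin 3))) : ⟪Torus.stokesMode k a c x, Torus.stokesMode m b c' x⟫_ℝ = 0 := by
  rw [Torus.stokesMode_apply, Torus.stokesMode_apply, real_inner_smul_left, real_inner_smul_right, hab,
    mul_zero, mul_zero]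

/-- `|eᵢ|² = 1`. -/
theorem freqNormSq_single (i : Fin 3) : freqNormSq (Pi.single i (1 : ℤ) : Fin 3 → ℤ) = 1 := by
  rw [← Torus.norm_latticeVec_sq, latticeVec_single]
  simp

/-- `|e_q + e_c|² = 2` for `q ≠ c`. -/
theorem freqNormSq_single_add_single {q c : Fin 3} (hqc : q ≠ c) :
    freqNormSq (Pi.single q (1 : ℤ) + Pi.single c (1 : ℤ) : Fin 3 → ℤ) = 2 := by
  rw [← Torus.norm_latticeVec_sq, latticeVec_add, latticeVec_single, latticeVec_single,
    norm_add_sq_real, EuclideanSpace.inner_single_left, PiLp.single_apply, if_neg hqc]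
  simp
  norm_num

/-! ## Two-mode fields `stokesMode k a c + stokesMode m b c` -/

/-- A two-mode field is smooth. -/
theorem isSmooth_twoMode (k m : Fin 3 → ℤ) (a b : (EuclideanSpace ℝ (Fin 3))) (c : Bool) :
    IsSmooth (⇑(Torus.stokesMode k a c) + ⇑(Torus.stokesMode m b c)) :=
  (Torus.isSmooth_stokesMode k a c).add (Torus.isSmooth_stokesMode m b c)

/-- A two-mode field with transverse amplitudes is divergence-free. -/
theorem isDivFree_twoMode {k m : Fin 3 → ℤ} {a b : (EuclideanSpace ℝ (Fin 3))} (hka : ⟪latticeVec k, a⟫_ℝ = 0)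
    (hmb : ⟪latticeVec m, b⟫_ℝ = 0) (c : Bool) :
    IsDivFree (⇑(Torus.stokesMode k a c) + ⇑(Torus.stokesMode m b c)) :=
  SteadyStatesLoudBounded.GpAdmissible.isDivFree_add (Torus.isSmooth_stokesMode k a c)
    (Torus.isSmooth_stokesMode m b c) (Torus.isDivFree_stokesMode hka c) (Torus.isDivFree_stokesMode hmb c)

/-- A two-mode field with non-zero frequencies is mean-free. -/
theorem hasZeroMean_twoMode {k m : Fin 3 → ℤ} (hk : k ≠ 0) (hm : m ≠ 0) (a b : (EuclideanSpace ℝ (Fin 3))) (c : Bool) :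
    HasZeroMean (⇑(Torus.stokesMode k a c) + ⇑(Torus.stokesMode m b c)) :=
  SteadyStatesLoudBounded.GpAdmissible.hasZeroMean_add (Torus.isSmooth_stokesMode k a c)
    (Torus.isSmooth_stokesMode m b c) (Torus.hasZeroMean_stokesMode hk a c)
    (Torus.hasZeroMean_stokesMode hm b c)

/-- **Energy of a two-mode field**: `∫ |V|² = (|a|² + |b|²)/2` (`k, m ≠ 0`, `a ⊥ b`). -/
theorem integral_norm_sq_twoMode {k m : Fin 3 → ℤ} (hk : k ≠ 0) (hm : m ≠ 0) {a b : (EuclideanSpace ℝ (Fin 3))}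
    (hab : ⟪a, b⟫_ℝ = 0) (c : Bool) :
    ∫ x, ‖(⇑(Torus.stokesMode k a c) + ⇑(Torus.stokesMode m b c)) x‖ ^ 2 = (‖a‖ ^ 2 + ‖b‖ ^ 2) / 2 := by
  have h : ∀ x, ‖(⇑(Torus.stokesMode k a c) + ⇑(Torus.stokesMode m b c)) x‖ ^ 2 =
      ‖Torus.stokesMode k a c x‖ ^ 2 + ‖Torus.stokesMode m b c x‖ ^ 2 := by
    intro x
    rw [Pi.add_apply, norm_add_sq_real, inner_stokesMode_stokesMode_eq_zero k m hab c c x, mul_zero,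
      add_zero]
  simp_rw [h]
  rw [integral_add (EnsembleRigidity.GPStatisticalRigidity.gpForce_integrable_norm_sq_stokesMode k a c)
      (EnsembleRigidity.GPStatisticalRigidity.gpForce_integrable_norm_sq_stokesMode m b c),
    EnsembleRigidity.GPStatisticalRigidity.gpForce_integral_norm_sq_stokesMode hk,
    EnsembleRigidity.GPStatisticalRigidity.gpForce_integral_norm_sq_stokesMode hm]
  ring

/-- **Enstrophy of a two-mode field**: `‖∇V‖₂² = 2π² (|k|²|a|² + |m|²|b|²)` (`k, m ≠ 0`, `a ⊥ b`),
through `‖∇V‖₂² = −∫⟪ΔV, V⟫` and `Δ stokesMode k = −4π²|k|² stokesMode k`. -/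
theorem gradNormSq_twoMode {k m : Fin 3 → ℤ} (hk : k ≠ 0) (hm : m ≠ 0) {a b : (EuclideanSpace ℝ (Fin 3))}
    (hab : ⟪a, b⟫_ℝ = 0) (c : Bool) :
    gradNormSq (⇑(Torus.stokesMode k a c) + ⇑(Torus.stokesMode m b c)) =
      2 * Real.pi ^ 2 * (freqNormSq k * ‖a‖ ^ 2 + freqNormSq m * ‖b‖ ^ 2) := by
  have hV := isSmooth_twoMode k m a b c
  have h1 := integral_inner_laplacian_self_eq_neg_gradNormSq_of_isSmooth hV
  have h0 : ∀ x, ⟪Torus.stokesMode k a c x, Torus.stokesMode m b c x⟫_ℝ = 0 :=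
    fun x => inner_stokesMode_stokesMode_eq_zero k m hab c c x
  have h0' : ∀ x, ⟪Torus.stokesMode m b c x, Torus.stokesMode k a c x⟫_ℝ = 0 :=
    fun x => by rw [real_inner_comm]; exact h0 x
  have h2 : ∀ x, ⟪laplacian (⇑(Torus.stokesMode k a c) + ⇑(Torus.stokesMode m b c)) x,
      (⇑(Torus.stokesMode k a c) + ⇑(Torus.stokesMode m b c)) x⟫_ℝ =
      -(Torus.stokesEigenvalue k * ‖Torus.stokesMode k a c x‖ ^ 2) -
        Torus.stokesEigenvalue m * ‖Torus.stokesMode m b c x‖ ^ 2 := by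
    intro x
    rw [laplacian_add_apply (Torus.isSmooth_stokesMode k a c) (Torus.isSmooth_stokesMode m b c),
      Torus.laplacian_stokesMode, Torus.laplacian_stokesMode, Pi.add_apply, inner_add_left,
      inner_add_right, inner_add_right, real_inner_smul_left, real_inner_smul_left,
      real_inner_smul_left, real_inner_smul_left, real_inner_self_eq_norm_sq,
      real_inner_self_eq_norm_sq, h0 x, h0' x]
    ring
  have iK := EnsembleRigidity.GPStatisticalRigidity.gpForce_integrable_norm_sq_stokesMode k a c
  have iM := EnsembleRigidity.GPStatisticalRigidity.gpForce_integrable_norm_sq_stokesMode m b c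
  have h3 : ∫ x, ⟪laplacian (⇑(Torus.stokesMode k a c) + ⇑(Torus.stokesMode m b c)) x,
      (⇑(Torus.stokesMode k a c) + ⇑(Torus.stokesMode m b c)) x⟫_ℝ =
      -(Torus.stokesEigenvalue k * (‖a‖ ^ 2 / 2)) - Torus.stokesEigenvalue m * (‖b‖ ^ 2 / 2) := by
    simp_rw [h2]
    have iK' : Integrable (fun x => -(Torus.stokesEigenvalue k * ‖Torus.stokesMode k a c x‖ ^ 2)) volume :=
      (iK.const_mul _).neg
    have iM' : Integrable (fun x => Torus.stokesEigenvalue m * ‖Torus.stokesMode m b c x‖ ^ 2) volume :=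
      iM.const_mul _
    rw [integral_sub iK' iM', integral_neg, integral_const_mul,
      integral_const_mul, EnsembleRigidity.GPStatisticalRigidity.gpForce_integral_norm_sq_stokesMode hk,
      EnsembleRigidity.GPStatisticalRigidity.gpForce_integral_norm_sq_stokesMode hm]
  rw [h3] at h1
  simp only [Torus.stokesEigenvalue] at h1
  linear_combination h1

/-- **Self-advection of a two-mode field.** -/
theorem convect_twoMode_self (k m : Fin 3 → ℤ) (a b : (EuclideanSpace ℝ (Fin 3))) (c : Bool) (x : (UnitAddTorus (Fin 3))) :
    Torus.convect (⇑(Torus.stokesMode k a c) + ⇑(Torus.stokesMode m b c))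
        (⇑(Torus.stokesMode k a c) + ⇑(Torus.stokesMode m b c)) x =
      (⟪latticeVec k, (⇑(Torus.stokesMode k a c) + ⇑(Torus.stokesMode m b c)) x⟫_ℝ *
          (2 * Real.pi * (if c then -(mFourier k x).im else (mFourier k x).re))) • a +
        (⟪latticeVec m, (⇑(Torus.stokesMode k a c) + ⇑(Torus.stokesMode m b c)) x⟫_ℝ *
          (2 * Real.pi * (if c then -(mFourier m x).im else (mFourier m x).re))) • b := by
  rw [convect_add_right _ ((Torus.isSmooth_stokesMode k a c).isContDiff (by simp))
      ((Torus.isSmooth_stokesMode m b c).isContDiff (by simp)),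
    convect_stokesMode_eq_smul, convect_stokesMode_eq_smul]

/-- **The quarter-period pair cancels the spill.** For amplitudes with `k ⊥ a`, `m ⊥ a`, `m ⊥ b`, the
self-advections of the cosine pair and of the sine pair add up to a single SINE mode of frequency
`k − m` along `a`: `(V⁺·∇)V⁺ + (V⁻·∇)V⁻ = −2π ⟪k, b⟫ sin(2π(k−m)·x) a`. -/
theorem convect_twoMode_pair (k m : Fin 3 → ℤ) {a b : (EuclideanSpace ℝ (Fin 3))} (hka : ⟪latticeVec k, a⟫_ℝ = 0)
    (hma : ⟪latticeVec m, a⟫_ℝ = 0) (hmb : ⟪latticeVec m, b⟫_ℝ = 0) (x : (UnitAddTorus (Fin 3))) :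
    Torus.convect (⇑(Torus.stokesMode k a true) + ⇑(Torus.stokesMode m b true))
          (⇑(Torus.stokesMode k a true) + ⇑(Torus.stokesMode m b true)) x +
        Torus.convect (⇑(Torus.stokesMode k a false) + ⇑(Torus.stokesMode m b false))
          (⇑(Torus.stokesMode k a false) + ⇑(Torus.stokesMode m b false)) x =
      (-(2 * Real.pi) * ⟪latticeVec k, b⟫_ℝ * (mFourier (k - m) x).im) • a := by
  rw [convect_twoMode_self, convect_twoMode_self, sub_eq_add_neg, mFourier_add, mFourier_neg]
  simp only [Pi.add_apply, Torus.stokesMode_apply, inner_add_right, real_inner_smul_right, hka, hma, hmb,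
    mul_zero, add_zero, zero_add, zero_mul, zero_smul, if_true, Bool.false_eq_true, if_false]
  rw [← add_smul]
  congr 1
  rw [Complex.mul_im, Complex.conj_re, Complex.conj_im]
  ring

/-! ## The six Galloway–Proctor atoms

The atom pair of the force component `sin(2πx_c) e_p` with pivot coordinate `q` (`{p, c, q} = {0, 1, 2}`):
frequencies `k = e_q + e_c`, `m = e_q`, amplitudes `a = A e_p`, `b = −B e_c`, both parities. -/

section Atoms

variable (A B : ℝ) {p c q : Fin 3}

/-- `e_q + e_c ≠ 0`. -/
theorem gpPair_k_ne_zero (hcq : c ≠ q) : (Pi.single q 1 + Pi.single c 1 : Fin 3 → ℤ) ≠ 0 := by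
  intro h
  have := congr_fun h q
  simp [hcq] at this

/-- `(e_q + e_c) ⊥ A e_p`. -/
theorem gpPair_hka (hpc : p ≠ c) (hpq : p ≠ q) :
    ⟪latticeVec (Pi.single q 1 + Pi.single c 1 : Fin 3 → ℤ), A • EuclideanSpace.single p (1 : ℝ)⟫_ℝ = 0 := by
  rw [latticeVec_add, latticeVec_single, latticeVec_single, real_inner_smul_right, inner_add_left,
    EuclideanSpace.inner_single_left, EuclideanSpace.inner_single_left, PiLp.single_apply, PiLp.single_apply,
    if_neg hpq.symm, if_neg hpc.symm]
  simp

/-- `e_q ⊥ A e_p`. -/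
theorem gpPair_hma (hpq : p ≠ q) :
    ⟪latticeVec (Pi.single q 1 : Fin 3 → ℤ), A • EuclideanSpace.single p (1 : ℝ)⟫_ℝ = 0 := by
  rw [latticeVec_single, real_inner_smul_right, EuclideanSpace.inner_single_left, PiLp.single_apply,
    if_neg hpq.symm]
  simp

/-- `e_q ⊥ (−B) e_c`. -/
theorem gpPair_hmb (hcq : c ≠ q) :
    ⟪latticeVec (Pi.single q 1 : Fin 3 → ℤ), (-B) • EuclideanSpace.single c (1 : ℝ)⟫_ℝ = 0 := by
  rw [latticeVec_single, real_inner_smul_right, EuclideanSpace.inner_single_left, PiLp.single_apply,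
    if_neg hcq.symm]
  simp

/-- `⟪e_q + e_c, −B e_c⟫ = −B`. -/
theorem gpPair_hkb (hcq : c ≠ q) :
    ⟪latticeVec (Pi.single q 1 + Pi.single c 1 : Fin 3 → ℤ), (-B) • EuclideanSpace.single c (1 : ℝ)⟫_ℝ = -B := by
  rw [latticeVec_add, latticeVec_single, latticeVec_single, real_inner_smul_right, inner_add_left,
    EuclideanSpace.inner_single_left, EuclideanSpace.inner_single_left, PiLp.single_apply, PiLp.single_apply,
    if_neg hcq.symm, if_pos rfl]
  simp

/-- `A e_p ⊥ (−B) e_c`. -/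
theorem gpPair_hab (hpc : p ≠ c) :
    ⟪A • EuclideanSpace.single p (1 : ℝ), (-B) • EuclideanSpace.single c (1 : ℝ)⟫_ℝ = 0 := by
  rw [real_inner_smul_left, real_inner_smul_right, EuclideanSpace.inner_single_left, PiLp.single_apply,
    if_neg hpc]
  simp

end Atoms


end Summit.AnomalousDissipation.AnomalousDissipation.Theorems.GPTameDefectFloor.Negative
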